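import Summits.BirchSwinnertonDyer.BirchSwinnertonDyer.Theorems.ThetaPartnerAtTwoSignedMainConjectureCMTwoRankZeroOfPubOfStubs
import Literature.NumberTheory.EllipticCurves.IwasawaAlgebraDivisibilityProofs
import Literature.NumberTheory.EllipticCurves.SkinnerUrban2014.CharacteristicIdealBaseChangeProofs
import Literature.NumberTheory.EllipticCurves.Kato2004.IwasawaCohomology
import Literature.NumberTheory.EllipticCurves.KatoFineSelmerDual
import Literature.NumberTheory.EllipticCurves.TateModuleContinuityProofs
import Literature.NumberTheory.EllipticCurves.Kobayashi2003.SignedSelmerModuleFiniteProofs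
import HarnessLib

/-!
# Route `ThetaPartnerAtTwo` (TP2), crux K2r0P `SignedMainConjectureCMTwoRankZeroOfPub` (stmt-BirchSwinnertonDyer-24945),
# line `rankzero` v14: what a LOWER `2`-adic Coleman–Poitou–Tate package must deliver — the length form (LDℓ)_A of the
# load-bearing stub from the `≥` half of Kato's §17.13 / Kobayashi's Thm. 7.4 four-term identity (route-independent)

HONEST FRAMING (cell `pub/bsd-wall`, W-ALL row 1; width seat `bsd-wall-tp2-p2-w2` g2, `--supports` only). THEOREMS ONLY — no definition,
no named fact, no instance, no `sorry`, no `Theses` import; the displayed package hypothesis of §2 IS research at `p = 2` for CM curves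
(its global clause is the EQUALITY half of Kato's main conjecture 12.10 for the CM form `f_A`, i.e. Rubin 1991 / Johnson-Leung–Kings 2011
transported by Kato §15, Lemma 15.13, away from the height-one prime `(2)`; its local clauses are the `+` Coleman map at `2`); nothing about
any Selmer group is asserted; this file closes no item; the crux is NOT proved; BSD is NOT proved by any of this.

## What is proved

* §1 (module theory, any commutative ring `R`): the REVERSE FOUR-TERM INEQUALITY. For `R`-linear `H →ᶜ P →ʲ X →ᵏ Y` with `c`
  injective, `ker j ≤ range c` (the DEEP half of exactness at `P`), `k ∘ j = 0` (the complex half at `X`), `k` SURJECTIVE, `ι : P ↪ R`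
  injective, and any `z ∈ H`: `ℓ_𝔭(Y) + ℓ_𝔭(R/(ι(c z))) ≤ ℓ_𝔭(X) + ℓ_𝔭(H/Rz) + ℓ_𝔭(R/range ι)` at every prime `𝔭`
  (`fourTerm_lengthAt_ge`) — the `≥` half of Kato's §17.13 identity ∕ of Kobayashi's proof of Thm. 7.4, complementary to the tree's
  `SignedKatoOffTwo.fourTerm_lengthAt_le_of_comp_eq_zero` (which uses the OTHER two half-exactnesses, no surjectivity of `k`, and no
  cokernel term). Consequence `lengthAt_quotient_le_of_fourTerm_ge`: if moreover `ℓ_𝔭(R/range ι) = 0` (the «Coleman map» `ι ∘ c` is onto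
  at `𝔭`), `ℓ_𝔭(R/(L)) ≤ ℓ_𝔭(R/(ι(c z)))` (`L ∣ Col(z)` at `𝔭`), `ℓ_𝔭(H/Rz) ≤ ℓ_𝔭(Y)` (the lower/equality half of a main conjecture
  WITHOUT `L`-functions at `𝔭`) and `ℓ_𝔭(Y) < ⊤`, then `ℓ_𝔭(R/(L)) ≤ ℓ_𝔭(X)`.
* §2 (`p = 2`, the crux class): `offTwoLower_of_lowerColemanPackageTwo` — the length form (LDℓ)_A of the load-bearing stub (LD±2^k)_A
  (made equivalent to the stub given torsion by `SignedLowerOffTwo.lowerUpTo_iff_lengthAt_quotient_le`, part 1, and wired to the crux body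
  by part 2 `…LowerOffTwoAtTwo`) FOLLOWS from the existence, for every class member `A`, cyclotomic datum, newform, Pollack pair at `2`, dual
  datum `D` of `Sel⁺(A/ℚ_∞)` with `X⁺` torsion and height-one `𝔭 ∌ 2`, of a **LOWER `2`-adic Coleman–Poitou–Tate package**: Kato's pinned
  `𝐇¹_Γ(T₂A)`-datum `I`, a fine dual datum `Y` (`X₀(A/ℚ_∞)`), a submodule `P ≤ Λ` (the image of the `+`/♭ Coleman map) with an
  INJECTIVE `col : 𝐇¹ → P`, maps `j : P → X⁺`, `k : X⁺ → X₀` with `ker j ≤ range col` (Poitou–Tate: a class of the signed local quotient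
  annihilating `Sel⁺(A/ℚ_∞)` comes from `𝐇¹` — the half of Kobayashi (7.21) that the UPPER bound does not use), `k ∘ j = 0` and `k` onto
  (the definitional halves: `Sel₀ ⊆ Sel⁺` dualised), `ℓ_𝔭(Λ/P) = 0` (the `+` Coleman map is onto at `𝔭 ∌ 2`: Kobayashi Thm. 6.2 is `p` odd),
  and an element `s ∈ 𝐇¹` (intended: Kato's zeta element of the CM form `f_A` = the image of the elliptic zeta element, Kato (15.16.1)) with
  `ℓ_𝔭(Λ/(L♭)) ≤ ℓ_𝔭(Λ/(col s))` («`L♭ ∣ Col⁺(z)` at `𝔭`»: Kobayashi Thm. 6.3 / Kato (15.12.2) at `2`) and `ℓ_𝔭(𝐇¹/Λs) ≤ ℓ_𝔭(X₀)` (the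
  EQUALITY half of Kato's Conj. 12.10 for `f_A` at `𝔭`: Kato Prop. 15.17's converse via Rubin/JLK and Lemma 15.13 at `𝔭 ∌ 2` — RESEARCH at
  `p = 2`). `ℓ_𝔭(X₀) < ⊤` is free (`k` onto, `X⁺` finitely generated torsion). The structure fact `ContinuousSMul ℤ₂ T₂A` is an instance binder
  of the hypothesis, discharged by `TateModule.continuousSMul_padicInt`.

So, kernel-checked: beyond the package the sister crux K3 consumes for the UPPER half (`SignedKatoOffTwo.colemanLengthTwo_of_colemanPackageTwo`:
complex at `P`, cover at `X⁺`, `ℓ_𝔭(Λ/(col s)) ≤ ℓ_𝔭(Λ/(L♭))`, Kato 13.4 (2)), the LOWER half for the CM partner needs exactly: the deep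
Poitou–Tate half at `P`, the `𝔭`-surjectivity of `Col⁺` off `2`, the reverse Coleman comparison, and the equality half of IMC for `f_A` off `(2)`.

References: [Kobayashi2003] Thm. 6.2–6.3 (p. 11), (7.17)–(7.21), Thm. 7.3, proof of Thm. 7.4 (pp. 12–13); [Kato2004Asterisque] Conj. 12.10
(p. 224), §15.12–15.17 (pp. 263–265), §17.13 (p. 280); [PollackRubin2004] Thm. 7.3 (p > 2); [JohnsonLeungKings2011] Thm. 5.2;
[Washington1997] §13.2.
-/

set_option autoImplicit false
-- the Theorems namespace of this sub repeats the summit name by design (D-0017 nested layout)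
set_option linter.dupNamespace false

noncomputable section

open scoped Classical NumberField MatrixGroups ModularForm

open NumberField IsDedekindDomain CongruenceSubgroup

namespace Summit.BirchSwinnertonDyer.BirchSwinnertonDyer.Theorems

open Literature.NumberTheory.EllipticCurves Literature.NumberTheory.GaloisRepresentations
  WeierstrassCurve ZpExtension Literature.NumberTheory.EllipticCurves.Kobayashi2003
  Literature.NumberTheory.EllipticCurves.Module Literature.NumberTheory.EllipticCurves.Kato2004
  Literature.NumberTheory.EllipticCurves.IwasawaDual Literature.NumberTheory.EllipticCurves.GreenbergVatsal2000
  Literature.NumberTheory.EllipticCurves.ModularForms Literature.NumberTheory.EllipticCurves.Rank1Residual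
  Literature.NumberTheory.EllipticCurves.Rank1Residual.Typed
  Summit.BirchSwinnertonDyer.Rank1Residual Summit.BirchSwinnertonDyer.Rank1Residual.Supersingular

namespace SignedLowerOffTwo

/-! ## §1 The reverse four-term inequality (any commutative ring) -/

section FourTerm

variable {R : Type*} [CommRing R] {H P X Y : Type*} [AddCommGroup H] [_root_.Module R H]
  [AddCommGroup P] [_root_.Module R P] [AddCommGroup X] [_root_.Module R X]
  [AddCommGroup Y] [_root_.Module R Y]

/-- `ℓ_𝔭(P/c(Z)) = ℓ_𝔭(H/Z) + ℓ_𝔭(P/range c)` for an INJECTIVE `c : H → P` and a submodule `Z ≤ H` (the tree's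
`SignedKatoOffTwo.lengthAt_quotient_map_eq_add`, re-proved to keep this file route-independent). [folklore] -/
private theorem lengthAt_quotient_map_eq_add (c : H →ₗ[R] P) (hc : Function.Injective c)
    (Z : Submodule R H) (𝔭 : PrimeSpectrum R) :
    lengthAt R (P ⧸ Submodule.map c Z) 𝔭 =
      lengthAt R (H ⧸ Z) 𝔭 + lengthAt R (P ⧸ LinearMap.range c) 𝔭 := by
  set M : Submodule R P := Submodule.map c Z with hM
  let φ : H →ₗ[R] P ⧸ M := M.mkQ ∘ₗ c
  have hkerφ : LinearMap.ker φ = Z := by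
    rw [LinearMap.ker_comp, Submodule.ker_mkQ, hM, Submodule.comap_map_eq_of_injective hc]
  have hrangeφ : LinearMap.range φ = (LinearMap.range c).map M.mkQ := LinearMap.range_comp _ _
  have hMle : M ≤ LinearMap.range c := by
    rw [hM, LinearMap.range_eq_map]; exact Submodule.map_mono le_top
  rw [lengthAt_eq_add_quotient (LinearMap.range φ) 𝔭]
  congr 1
  · rw [← lengthAt_eq_of_linearEquiv φ.quotKerEquivRange 𝔭,
      lengthAt_eq_of_linearEquiv (Submodule.quotEquivOfEq _ _ hkerφ) 𝔭]
  · rw [lengthAt_eq_of_linearEquiv (Submodule.quotEquivOfEq _ _ hrangeφ) 𝔭,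
      lengthAt_eq_of_linearEquiv (Submodule.quotientQuotientEquivQuotient M (LinearMap.range c) hMle) 𝔭]

/-- `ℓ_𝔭(R/(ι(c z))) = ℓ_𝔭(P/c(Rz)) + ℓ_𝔭(R/range ι)` for an injective `ι : P → R` (the short exact sequence
`0 → P/c(Rz) → R/(ι c z) → R/ι(P) → 0`). [folklore] -/
private theorem lengthAt_quotient_span_eq_add (ι : P →ₗ[R] R) (hι : Function.Injective ι) (c : H →ₗ[R] P)
    (z : H) (𝔭 : PrimeSpectrum R) :
    lengthAt R (R ⧸ Ideal.span {ι (c z)}) 𝔭 =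
      lengthAt R (P ⧸ Submodule.map c (Submodule.span R {z})) 𝔭 + lengthAt R (R ⧸ LinearMap.range ι) 𝔭 := by
  set N : Submodule R R := Ideal.span {ι (c z)} with hN
  -- `ψ : P → R/N`, kernel `c(Rz)`, range `(range ι)/N`
  let ψ : P →ₗ[R] R ⧸ N := N.mkQ ∘ₗ ι
  have hkerψ : LinearMap.ker ψ = Submodule.map c (Submodule.span R {z}) := by
    ext y
    rw [LinearMap.mem_ker, LinearMap.comp_apply, Submodule.mkQ_apply, Submodule.Quotient.mk_eq_zero, hN,
      Ideal.mem_span_singleton', Submodule.map_span, Set.image_singleton, Submodule.mem_span_singleton]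
    constructor
    · rintro ⟨a, ha⟩
      exact ⟨a, hι (by rw [map_smul, smul_eq_mul, ha])⟩
    · rintro ⟨a, rfl⟩
      exact ⟨a, by rw [map_smul, smul_eq_mul]⟩
  have hrangeψ : LinearMap.range ψ = (LinearMap.range ι).map N.mkQ := LinearMap.range_comp _ _
  have hNle : N ≤ LinearMap.range ι := by
    rw [hN, Ideal.span_singleton_le_iff_mem]
    exact ⟨c z, rfl⟩
  rw [lengthAt_eq_add_quotient (LinearMap.range ψ) 𝔭]
  congr 1
  · rw [← lengthAt_eq_of_linearEquiv ψ.quotKerEquivRange 𝔭,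
      lengthAt_eq_of_linearEquiv (Submodule.quotEquivOfEq _ _ hkerψ) 𝔭]
  · rw [lengthAt_eq_of_linearEquiv (Submodule.quotEquivOfEq _ _ hrangeψ) 𝔭,
      lengthAt_eq_of_linearEquiv (Submodule.quotientQuotientEquivQuotient N (LinearMap.range ι) hNle) 𝔭]

/-- **The REVERSE four-term inequality.** For `R`-linear `H →ᶜ P →ʲ X →ᵏ Y` with `c` injective, `ker j ≤ range c` (the
deep half of exactness at `P`), `k ∘ j = 0` (the complex half at `X`), `k` surjective, `ι : P ↪ R` injective, and `z ∈ H`: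
`ℓ_𝔭(Y) + ℓ_𝔭(R/(ι(c z))) ≤ ℓ_𝔭(X) + ℓ_𝔭(H/Rz) + ℓ_𝔭(R/range ι)` at every prime `𝔭` (in `ℕ∞`, no finiteness needed).
Proof: `ℓ(X) = ℓ(range j) + ℓ(X/range j)`; `ℓ(Y) = ℓ(X/ker k) ≤ ℓ(X/range j)` (`range j ≤ ker k`, `k` onto);
`ℓ(P/range c) ≤ ℓ(P/ker j) = ℓ(range j)` (`ker j ≤ range c`); `ℓ(R/(ι c z)) = ℓ(P/c(Rz)) + ℓ(R/range ι) =
ℓ(H/Rz) + ℓ(P/range c) + ℓ(R/range ι)` (`c`, `ι` injective). The `≥` half of Kato's §17.13 length identity ∕ of the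
proof of Kobayashi's Thm. 7.4, complementary to the tree's `SignedKatoOffTwo.fourTerm_lengthAt_le_of_comp_eq_zero`.
[cite: Kato2004Asterisque, §17.13 (p. 280)] [cite: Kobayashi2003, (7.17)–(7.21) and proof of Thm. 7.4 (pp. 12–13)] -/
theorem fourTerm_lengthAt_ge (ι : P →ₗ[R] R) (hι : Function.Injective ι) (c : H →ₗ[R] P)
    (hc : Function.Injective c) (j : P →ₗ[R] X) (k : X →ₗ[R] Y) (hjc : LinearMap.ker j ≤ LinearMap.range c)
    (hkj : ∀ x, k (j x) = 0) (hk : Function.Surjective k) (z : H) (𝔭 : PrimeSpectrum R) :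
    lengthAt R Y 𝔭 + lengthAt R (R ⧸ Ideal.span {ι (c z)}) 𝔭 ≤
      lengthAt R X 𝔭 + lengthAt R (H ⧸ Submodule.span R {z}) 𝔭 + lengthAt R (R ⧸ LinearMap.range ι) 𝔭 := by
  -- `ℓ(X) = ℓ(range j) + ℓ(X / range j)`
  have hX : lengthAt R X 𝔭 =
      lengthAt R (LinearMap.range j) 𝔭 + lengthAt R (X ⧸ LinearMap.range j) 𝔭 :=
    lengthAt_eq_add_quotient (LinearMap.range j) 𝔭
  -- `ℓ(Y) = ℓ(X / ker k) ≤ ℓ(X / range j)` (`range j ≤ ker k`, `k` onto)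
  have h1 : lengthAt R Y 𝔭 ≤ lengthAt R (X ⧸ LinearMap.range j) 𝔭 := by
    have hle : LinearMap.range j ≤ LinearMap.ker k := by
      rintro _ ⟨x, rfl⟩
      exact hkj x
    have hsurj : Function.Surjective ((LinearMap.range j).mapQ (LinearMap.ker k) LinearMap.id hle) := by
      intro q
      induction q using Submodule.Quotient.induction_on with
      | H x => exact ⟨Submodule.Quotient.mk x, rfl⟩
    rw [← lengthAt_eq_of_linearEquiv (k.quotKerEquivOfSurjective hk) 𝔭]
    exact lengthAt_le_of_surjective _ hsurj 𝔭
  -- `ℓ(P / range c) ≤ ℓ(P / ker j) = ℓ(range j)` (`ker j ≤ range c`)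
  have h2 : lengthAt R (P ⧸ LinearMap.range c) 𝔭 ≤ lengthAt R (LinearMap.range j) 𝔭 := by
    have hsurj : Function.Surjective ((LinearMap.ker j).mapQ (LinearMap.range c) LinearMap.id hjc) := by
      intro q
      induction q using Submodule.Quotient.induction_on with
      | H x => exact ⟨Submodule.Quotient.mk x, rfl⟩
    rw [← lengthAt_eq_of_linearEquiv j.quotKerEquivRange 𝔭]
    exact lengthAt_le_of_surjective _ hsurj 𝔭
  -- `ℓ(R/(ι c z)) = ℓ(H/Rz) + ℓ(P/range c) + ℓ(R/range ι)`
  have h3 : lengthAt R (R ⧸ Ideal.span {ι (c z)}) 𝔭 =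
      lengthAt R (H ⧸ Submodule.span R {z}) 𝔭 + lengthAt R (P ⧸ LinearMap.range c) 𝔭 +
        lengthAt R (R ⧸ LinearMap.range ι) 𝔭 := by
    rw [lengthAt_quotient_span_eq_add ι hι c z 𝔭, lengthAt_quotient_map_eq_add c hc _ 𝔭]
  calc lengthAt R Y 𝔭 + lengthAt R (R ⧸ Ideal.span {ι (c z)}) 𝔭
      ≤ lengthAt R (X ⧸ LinearMap.range j) 𝔭 +
          (lengthAt R (H ⧸ Submodule.span R {z}) 𝔭 + lengthAt R (LinearMap.range j) 𝔭 +
            lengthAt R (R ⧸ LinearMap.range ι) 𝔭) := by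
        rw [h3]
        exact add_le_add h1 (add_le_add (add_le_add le_rfl h2) le_rfl)
    _ = lengthAt R X 𝔭 + lengthAt R (H ⧸ Submodule.span R {z}) 𝔭 + lengthAt R (R ⧸ LinearMap.range ι) 𝔭 := by
        rw [hX]; ring

/-- **`ℓ_𝔭(R/(L)) ≤ ℓ_𝔭(X)` from a reverse four-term package.** In the situation of `fourTerm_lengthAt_ge`, if moreover
`ℓ_𝔭(R/range ι) = 0` (the composite «Coleman map» `ι ∘ c : H → R` has `𝔭`-trivial cokernel), `ℓ_𝔭(R/(L)) ≤ ℓ_𝔭(R/(ι(c z)))`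
(`L` divides `ι(c z)` at `𝔭`), `ℓ_𝔭(H/Rz) ≤ ℓ_𝔭(Y)` (the lower half of a main conjecture without `L`-functions at `𝔭`) and
`ℓ_𝔭(Y) < ⊤`, then `ℓ_𝔭(R/(L)) ≤ ℓ_𝔭(X)` (cancel the finite `ℓ_𝔭(Y)`). [cite: Kobayashi2003, proof of Thm. 7.4 (p. 13)]
[cite: Kato2004Asterisque, §17.13 (p. 280)] -/
theorem lengthAt_quotient_le_of_fourTerm_ge (ι : P →ₗ[R] R) (hι : Function.Injective ι) (c : H →ₗ[R] P)
    (hc : Function.Injective c) (j : P →ₗ[R] X) (k : X →ₗ[R] Y) (hjc : LinearMap.ker j ≤ LinearMap.range c)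
    (hkj : ∀ x, k (j x) = 0) (hk : Function.Surjective k) (z : H) (𝔭 : PrimeSpectrum R) {L : R}
    (hcoker : lengthAt R (R ⧸ LinearMap.range ι) 𝔭 = 0)
    (hL : lengthAt R (R ⧸ Ideal.span {L}) 𝔭 ≤ lengthAt R (R ⧸ Ideal.span {ι (c z)}) 𝔭)
    (hz : lengthAt R (H ⧸ Submodule.span R {z}) 𝔭 ≤ lengthAt R Y 𝔭) (hY : lengthAt R Y 𝔭 ≠ ⊤) :
    lengthAt R (R ⧸ Ideal.span {L}) 𝔭 ≤ lengthAt R X 𝔭 := by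
  have h4 := fourTerm_lengthAt_ge ι hι c hc j k hjc hkj hk z 𝔭
  rw [hcoker, add_zero] at h4
  have h : lengthAt R Y 𝔭 + lengthAt R (R ⧸ Ideal.span {L}) 𝔭 ≤ lengthAt R Y 𝔭 + lengthAt R X 𝔭 :=
    calc lengthAt R Y 𝔭 + lengthAt R (R ⧸ Ideal.span {L}) 𝔭
        ≤ lengthAt R Y 𝔭 + lengthAt R (R ⧸ Ideal.span {ι (c z)}) 𝔭 := add_le_add le_rfl hL
      _ ≤ lengthAt R X 𝔭 + lengthAt R (H ⧸ Submodule.span R {z}) 𝔭 := h4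
      _ ≤ lengthAt R X 𝔭 + lengthAt R Y 𝔭 := add_le_add le_rfl hz
      _ = lengthAt R Y 𝔭 + lengthAt R X 𝔭 := add_comm _ _
  exact (WithTop.add_le_add_iff_left hY).mp h

end FourTerm

/-! ## §2 `p = 2`: (LDℓ)_A from a LOWER `2`-adic Coleman–Poitou–Tate package -/

section AtTwo

/-- **(LDℓ)_A from a LOWER `2`-adic Coleman–Poitou–Tate package.** If for every CM `A/ℚ` (globally minimal) of analytic rank `0`,
good supersingular at `2`, `a₂ = 0`, `2 ∣ #Ш(A)·∏c_ℓ(A)`, every cyclotomic datum matching the variable, newform `f`, period ratio `ϖ`,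
Pollack pair `(L♯, L♭)` at `2`, dual datum `D` of `Sel⁺(A/ℚ_∞)` with `X⁺` torsion, and height-one `𝔭 ∌ 2`, there are: a pinned
`𝐇¹_Γ(T₂A)`-datum `I`, a fine dual datum `Y` (`X₀(A/ℚ_∞)`), a submodule `P ≤ Λ` with an injective `col : 𝐇¹ → P`, maps `j : P → X⁺`,
`k : X⁺ → X₀` with `ker j ≤ range col` (deep Poitou–Tate half), `k ∘ j = 0` and `k` onto (definitional halves), `ℓ_𝔭(Λ/P) = 0` (`Col⁺` onto
at `𝔭`), and `s ∈ 𝐇¹` with `ℓ_𝔭(Λ/(L♭)) ≤ ℓ_𝔭(Λ/(col s))` (`L♭ ∣ Col⁺(s)` at `𝔭`) and `ℓ_𝔭(𝐇¹/Λs) ≤ ℓ_𝔭(X₀)` (the EQUALITY half of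
Kato's IMC for `f_A` at `𝔭` — RESEARCH at `p = 2`), THEN (LDℓ)_A: `ℓ_𝔭(Λ/(L♭)) ≤ ℓ_𝔭(X⁺(A/ℚ_∞))` for all such data (§1; `ℓ_𝔭(X₀) < ⊤`
because `k` is onto and `X⁺` is finitely generated torsion). The structure fact `ContinuousSMul ℤ₂ T₂A` binding `I` is discharged by
`TateModule.continuousSMul_padicInt`. [cite: Kobayashi2003, Thm. 6.2–6.3 (p. 11), (7.21), proof of Thm. 7.4 (p. 13)]
[cite: Kato2004Asterisque, Conj. 12.10 (p. 224), Lemma 15.13 and (15.16.1) (pp. 264–265), §17.13 (p. 280)] [cite: PollackRubin2004, Thm. 7.3 (p > 2)] -/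
theorem offTwoLower_of_lowerColemanPackageTwo
    (hPkg : ∀ (A : WeierstrassCurve ℚ) [A.IsElliptic] [A.IsGloballyMinimal],
      A.HasCM → A.analyticRank = 0 → GoodSS A 2 → A.frobeniusTrace 2 = 0 →
      2 ∣ A.shaOrder * A.tamagawaProduct →
      ∀ (κ : ZpExtension ℚ 2) (γ : Field.absoluteGaloisGroup ℚ),
        κ.IsCyclotomic → κ.IsTopGenerator γ → IsCyclotomicVariable 2 γ →
      ∀ [NeZero (A.conductorNorm ℤ)] (f : CuspForm (Gamma0 (A.conductorNorm ℤ)) 2),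
        IsNewformOf A f → ∀ (ϖ : ℚ), (ϖ : ℝ) * A.realPeriodRat = plusPeriod f →
      ∀ (Lplus Lminus : IwasawaAlgebra 2), IsPollackPair f 2 Lplus Lminus →
      ∀ (D : SignedSelmerDualData A κ γ 1) [ContinuousSMul ℤ_[2] (A.tateModule 2)],
        Module.IsTorsion (IwasawaAlgebra 2) D.X →
        ∀ 𝔭 : PrimeSpectrum (IwasawaAlgebra 2), 𝔭.asIdeal.height = 1 →
          PowerSeries.C (2 : ℤ_[2]) ∉ 𝔭.asIdeal →
        ∃ (I : Kato2004.IwasawaH1Data A 2 κ γ) (Y : A.FineSelmerDualData κ γ)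
          (P : Submodule (IwasawaAlgebra 2) (IwasawaAlgebra 2))
          (col : I.H →ₗ[IwasawaAlgebra 2] P) (j : P →ₗ[IwasawaAlgebra 2] D.X)
          (k : D.X →ₗ[IwasawaAlgebra 2] Y.X) (s : I.H),
          Function.Injective col ∧ LinearMap.ker j ≤ LinearMap.range col ∧ (∀ x, k (j x) = 0) ∧
          Function.Surjective k ∧
          lengthAt (IwasawaAlgebra 2) (IwasawaAlgebra 2 ⧸ P) 𝔭 = 0 ∧
          lengthAt (IwasawaAlgebra 2) (IwasawaAlgebra 2 ⧸ Ideal.span {kobayashiL 1 Lplus Lminus}) 𝔭 ≤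
            lengthAt (IwasawaAlgebra 2) (IwasawaAlgebra 2 ⧸ Ideal.span {(P.subtype (col s))}) 𝔭 ∧
          lengthAt (IwasawaAlgebra 2) (I.H ⧸ Submodule.span (IwasawaAlgebra 2) {s}) 𝔭 ≤
            lengthAt (IwasawaAlgebra 2) Y.X 𝔭) :
    ∀ (A : WeierstrassCurve ℚ) [A.IsElliptic] [A.IsGloballyMinimal],
      A.HasCM → A.analyticRank = 0 → GoodSS A 2 → A.frobeniusTrace 2 = 0 →
      2 ∣ A.shaOrder * A.tamagawaProduct →
      ∀ (κ : ZpExtension ℚ 2) (γ : Field.absoluteGaloisGroup ℚ),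
        κ.IsCyclotomic → κ.IsTopGenerator γ → IsCyclotomicVariable 2 γ →
      ∀ [NeZero (A.conductorNorm ℤ)] (f : CuspForm (Gamma0 (A.conductorNorm ℤ)) 2),
        IsNewformOf A f → ∀ (ϖ : ℚ), (ϖ : ℝ) * A.realPeriodRat = plusPeriod f →
      ∀ (Lplus Lminus : IwasawaAlgebra 2), IsPollackPair f 2 Lplus Lminus →
      ∀ (D : SignedSelmerDualData A κ γ 1), Module.IsTorsion (IwasawaAlgebra 2) D.X →
        ∀ 𝔭 : PrimeSpectrum (IwasawaAlgebra 2), 𝔭.asIdeal.height = 1 →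
          PowerSeries.C (2 : ℤ_[2]) ∉ 𝔭.asIdeal →
          lengthAt (IwasawaAlgebra 2) (IwasawaAlgebra 2 ⧸ Ideal.span {kobayashiL 1 Lplus Lminus}) 𝔭 ≤
            lengthAt (IwasawaAlgebra 2) D.X 𝔭 := by
  intro A _ _ hcm hr hss ha hz κ γ hκ hγ hcv _ f hf ϖ hϖ Lplus Lminus hPP D hX 𝔭 h𝔭 hp𝔭
  haveI : ContinuousSMul ℤ_[2] (A.tateModule 2) := TateModule.continuousSMul_padicInt
  haveI : Module.Finite (IwasawaAlgebra 2) D.X := D.moduleFinite hγ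
  obtain ⟨I, Y, P, col, j, k, s, hcol, hjc, hkj, hk, hcoker, hdiv, hIMC⟩ :=
    hPkg A hcm hr hss ha hz κ γ hκ hγ hcv f hf ϖ hϖ Lplus Lminus hPP D hX 𝔭 h𝔭 hp𝔭
  -- `ℓ_𝔭(X₀) ≤ ℓ_𝔭(X⁺) < ⊤`
  have hXfin : lengthAt (IwasawaAlgebra 2) D.X 𝔭 ≠ ⊤ := by
    obtain ⟨-, -, -, hfin, -, -⟩ := SkinnerUrban2014.exists_charIdeal_eq_span_prod (M := D.X) hX
    exact hfin 𝔭 h𝔭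
  have hYfin : lengthAt (IwasawaAlgebra 2) Y.X 𝔭 ≠ ⊤ :=
    ne_top_of_le_ne_top hXfin (lengthAt_le_of_surjective k hk 𝔭)
  have hrange : LinearMap.range P.subtype = P := P.range_subtype
  have hcoker' : lengthAt (IwasawaAlgebra 2) (IwasawaAlgebra 2 ⧸ LinearMap.range P.subtype) 𝔭 = 0 := by
    rw [lengthAt_eq_of_linearEquiv (Submodule.quotEquivOfEq _ _ hrange) 𝔭]; exact hcoker
  exact lengthAt_quotient_le_of_fourTerm_ge P.subtype P.injective_subtype col hcol j k hjc hkj hk s 𝔭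
    hcoker' hdiv hIMC hYfin

end AtTwo

end SignedLowerOffTwo

end Summit.BirchSwinnertonDyer.BirchSwinnertonDyer.Theorems

end
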